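import Summits.QuantumFields.YangMills.Theorems.LangevinControlUVFemtoCurvatureTwoPointCDefs
import Summits.QuantumFields.YangMills.Theorems.LangevinControlUVFemtoCurvatureTwoPointCStubTwoLoopAdmissible

/-!
# Stub `twoLoopCoupling_bareSize` for line `Sketch` of crux `FemtoCurvatureTwoPointC`

Pure real analysis: the BARE-SIZE clause `c₈ ≤ β · u(8, β)` (`β ≥ β₀`) for the explicit two-loop
asymptotic-freedom coupling `u = twoLoopCoupling κ c₀ b₀ q` (`…CDefs`), `κ > 0`, `q ≥ 0`.

On the smallest box `L = 8` the finite-size term of the RG time vanishes (`log (8 / 8) = 0`), so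
`T(8, β) = y - q · log (y + q)` with `y = max (κ β + c₀) 1 ≥ 1`. Bounding every logarithm linearly
(`log x ≤ x - 1`) gives `|T(8, β)| ≤ y + q · (y + q)` and
`ψ_q(t) ≤ (1 + q) · (1 + |t|) + q · e`, whence `ψ_q(T(8, β)) ≤ M · β` for `β ≥ 1` with the explicit
constant `M = (1 + q) · (1 + K + q · (K + q)) + q · e`, `K = κ + |c₀| + 1`. Since `ψ_q > 0`
(`twoLoopAdm_psi_pos`), `β · u(8, β) = β / ψ_q(T(8, β)) ≥ 1 / M =: c₈ > 0` for all `β ≥ β₀ := 1`.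
-/

set_option autoImplicit false

noncomputable section

namespace Summit.QuantumFields.YangMills.Theorems.FemtoCurvatureTwoPointC

/-- Linear majorant of the two-loop profile: `ψ_q(t) ≤ (1 + q) · (1 + |t|) + q · e` for `q ≥ 0`
(`exp (min t 0) ≤ 1`, `max t 0 ≤ |t|`, `log x ≤ x - 1`). [folklore] -/
theorem bareSize_psi_le {q : ℝ} (hq : 0 ≤ q) (t : ℝ) :
    twoLoopPsi q t ≤ (1 + q) * (1 + |t|) + q * Real.exp 1 := by
  have h1 : Real.exp (min t 0) ≤ 1 := Real.exp_le_one_iff.2 (min_le_right t 0)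
  have h2 : max t 0 ≤ |t| := max_le (le_abs_self t) (abs_nonneg t)
  have h3 : Real.log (max t 0 + Real.exp 1) ≤ max t 0 + Real.exp 1 - 1 :=
    Real.log_le_sub_one_of_pos (add_pos_of_nonneg_of_pos (le_max_right t 0) (Real.exp_pos 1))
  have h4 : (1 + q) * Real.exp (min t 0) ≤ (1 + q) * 1 :=
    mul_le_mul_of_nonneg_left h1 (by linarith)
  have h5 : q * (Real.log (max t 0 + Real.exp 1) - 1) ≤ q * (|t| + Real.exp 1) :=
    mul_le_mul_of_nonneg_left (by linarith) hq
  simp only [twoLoopPsi]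
  linarith

/-- Linear bound on the two-loop RG invariant: for `y ≥ 1`, `q ≥ 0`,
`|y - q · log (y + q)| ≤ y + q · (y + q)` (`0 ≤ log (y + q) ≤ y + q - 1`). [folklore] -/
theorem bareSize_abs_sub_mul_log_le {y q : ℝ} (hy : 1 ≤ y) (hq : 0 ≤ q) :
    |y - q * Real.log (y + q)| ≤ y + q * (y + q) := by
  have hl0 : 0 ≤ Real.log (y + q) := Real.log_nonneg (by linarith)
  have hl1 : Real.log (y + q) ≤ y + q - 1 := Real.log_le_sub_one_of_pos (by linarith)
  have h1 : 0 ≤ q * Real.log (y + q) := mul_nonneg hq hl0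
  have h2 : q * Real.log (y + q) ≤ q * (y + q) :=
    mul_le_mul_of_nonneg_left (by linarith) hq
  have h3 : 0 ≤ q * (y + q) := mul_nonneg hq (by linarith)
  rw [abs_le]
  constructor <;> linarith

/-- On the smallest box `L = 8` the finite-size term vanishes:
`T(8, β) = y - q · log (y + q)`, `y = max (κ β + c₀) 1`. [folklore] -/
theorem bareSize_twoLoopT_eight (κ c₀ b₀ q β : ℝ) :
    twoLoopT κ c₀ b₀ q 8 β = max (κ * β + c₀) 1 - q * Real.log (max (κ * β + c₀) 1 + q) := by
  have h8 : ((8 : ℕ) : ℝ) / 8 = 1 := by norm_num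
  simp only [twoLoopT, h8, Real.log_one, mul_zero, sub_zero]

/-- Linear growth of the inverse coupling on the smallest box: for `κ > 0`, `q ≥ 0` and `β ≥ 1`,
`ψ_q(T(8, β)) ≤ M · β` with `M = (1 + q) · (1 + K + q · (K + q)) + q · e`, `K = κ + |c₀| + 1`.
[folklore] -/
theorem bareSize_psi_T_eight_le (κ c₀ b₀ q : ℝ) (hκ : 0 < κ) (hq : 0 ≤ q) (β : ℝ) (hβ : 1 ≤ β) :
    twoLoopPsi q (twoLoopT κ c₀ b₀ q 8 β) ≤
      ((1 + q) * (1 + (κ + |c₀| + 1) + q * ((κ + |c₀| + 1) + q)) + q * Real.exp 1) * β := by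
  rw [bareSize_twoLoopT_eight]
  have hy1 : 1 ≤ max (κ * β + c₀) 1 := le_max_right _ _
  have hc₀ : c₀ ≤ |c₀| * β := by
    calc c₀ ≤ |c₀| := le_abs_self c₀
      _ = |c₀| * 1 := (mul_one _).symm
      _ ≤ |c₀| * β := mul_le_mul_of_nonneg_left hβ (abs_nonneg c₀)
  have hyK : max (κ * β + c₀) 1 ≤ (κ + |c₀| + 1) * β := by
    refine max_le ?_ ?_
    · nlinarith [abs_nonneg c₀]
    · nlinarith [abs_nonneg c₀, hκ.le]
  have hT : |max (κ * β + c₀) 1 - q * Real.log (max (κ * β + c₀) 1 + q)| ≤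
      max (κ * β + c₀) 1 + q * (max (κ * β + c₀) 1 + q) :=
    bareSize_abs_sub_mul_log_le hy1 hq
  have hqβ : q ≤ q * β := le_mul_of_one_le_right hq hβ
  have hyq : max (κ * β + c₀) 1 + q ≤ ((κ + |c₀| + 1) + q) * β := by linarith
  have hqyq : q * (max (κ * β + c₀) 1 + q) ≤ q * (((κ + |c₀| + 1) + q) * β) :=
    mul_le_mul_of_nonneg_left hyq hq
  have hψ := bareSize_psi_le hq (max (κ * β + c₀) 1 - q * Real.log (max (κ * β + c₀) 1 + q))
  have h1q : (0 : ℝ) ≤ 1 + q := by linarith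
  have habs : 1 + |max (κ * β + c₀) 1 - q * Real.log (max (κ * β + c₀) 1 + q)| ≤
      (1 + (κ + |c₀| + 1) + q * ((κ + |c₀| + 1) + q)) * β := by linarith
  have hmul := mul_le_mul_of_nonneg_left habs h1q
  have he : q * Real.exp 1 ≤ q * Real.exp 1 * β :=
    le_mul_of_one_le_right (mul_nonneg hq (Real.exp_pos 1).le) hβ
  linarith

/-- **Bare size of the explicit two-loop coupling.** For `κ > 0` and `q ≥ 0` there are `c₈ > 0` and a
threshold `β₀` with `c₈ ≤ β · u(8, β)` for all `β ≥ β₀`, `u = twoLoopCoupling κ c₀ b₀ q`: on the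
smallest box the two-loop coupling is at least of bare size `c₈ / β`. Explicitly `β₀ = 1` and
`c₈ = 1 / M`, `M = (1 + q) · (1 + K + q · (K + q)) + q · e`, `K = κ + |c₀| + 1`. -/
theorem twoLoopCoupling_bareSize :
    ∀ (κ c₀ b₀ q : ℝ), 0 < κ → 0 ≤ q → ∃ (c₈ β₀ : ℝ), 0 < c₈ ∧ ∀ β : ℝ, β₀ ≤ β → c₈ ≤ β * twoLoopCoupling κ c₀ b₀ q 8 β := by
  intro κ c₀ b₀ q hκ hq
  have hM : 0 < (1 + q) * (1 + (κ + |c₀| + 1) + q * ((κ + |c₀| + 1) + q)) + q * Real.exp 1 := by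
    positivity
  refine ⟨((1 + q) * (1 + (κ + |c₀| + 1) + q * ((κ + |c₀| + 1) + q)) + q * Real.exp 1)⁻¹, 1,
    inv_pos.2 hM, fun β hβ => ?_⟩
  have hψpos : 0 < twoLoopPsi q (twoLoopT κ c₀ b₀ q 8 β) := twoLoopAdm_psi_pos q hq _
  show _ ≤ β * (twoLoopPsi q (twoLoopT κ c₀ b₀ q 8 β))⁻¹
  rw [le_mul_inv_iff₀ hψpos, inv_mul_le_iff₀ hM]
  exact bareSize_psi_T_eight_le κ c₀ b₀ q hκ hq β hβ

end Summit.QuantumFields.YangMills.Theorems.FemtoCurvatureTwoPointC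

end
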